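import Summits.QuantumFields.YangMills.Theorems.BalabanUVNodesN11K1ResidualBlindReduction

/-!
# DAG node N11 ∕ key K1⁹ — THE SUPPORT CONDITIONS AT THE UNIT-WEIGHT RESIDUAL ARE R-LEVEL: next to every `θ` the history-adapted indicator residual
# `ζ0_j(Y) := 𝟙{Y = Ω_{j+1}ᶜ}`, `quad_j := 0` obeys every row OUTRIGHT (laws, two-scale locality, partition of unity) and turns the reference new side `J⁰_P(s)` of the
# by-fiat 𝐒-laws into the BARE new side `I⁰_P(s)` — 11a's `𝐓_{k+1}(s)` with unit residual weights on the pure exponential `e^{A_{k+1}(s)}∘U` — a function of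
# `θ.toStage13RParams` alone; hence K1⁹'s consequent follows from its residual-blind remainder and an R-LEVEL support inclusion «supp ρ_{k+1}(s) ⊆ supp I⁰_P(s) a.e. on the
# χ_{k+1}(s)-support», with `ZhUnity` MANUFACTURED, not assumed (count-neutral, LOCATED; FLAG №15 kernel certificate #4: the residual slots carry NO content in K1⁹ v10)

HEADER — WORK-UNIT METADATA.  Cell `pub-ymgap`, YM-PLAN Track A (HUMAN RULING D-0062), seat `pub-ymgap-dag-n11-d` (g35; N11 [B14], s2), route `BalabanUVNodes`, item K1⁹ =
stmt-QuantumFields-27364 (helper lane, `--kind proof --supports 27364 --as helper`, count-neutral).  [III] = [Balaban1988Convergent], [IV] = [Balaban1989LargeFieldI], [V] =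
[Balaban1989LargeFieldII].  Over this seat's `…N11K1ResidualBlindReduction` (g35 I: `exists_revision₁₃_cor3_iff_of_sameR`, `betaOfRecord₁₃_eq_of_sameR`), `…N11K1BFaceSect2FormBySupports`
(g34 H: `exists_thm1Printed_datum_by_fiat_of_supports_of_hypotheses`), `…N11AllStepsQuadSlot` (g34 D: `tkBranchOfRecord_congr_below`), `…N11NoExpansionDiagonalCoPH`
(`sect2Slot_congr_residual`: the §2 slot reads NO component of the residual), `…N11TopPairQuadSlotK1Hypotheses` (the `sameR` transports), RECORD 13 v1.7 `H` (`WtOfRecord₁₃H`,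
`WtOfRecord₁₃H_chiA`, rows `zhLaws` ∕ `zhLocal`, guard `ZhUnity`), 12a (`TkResidualW.Laws`, `chiAW`), 12b∕T1′ (`TkResidualW.LocalLaws` = print's two-scale law), 11a (`TkOfRecord_apply`).

WHY ∕ WHAT.  FILE I reduced K1⁹'s consequent to its residual-blind remainder (`Cor3_250` at a version, the window, the run rows) PLUS the per-history SUPPORT conditions of H, which
read `θ`'s OWN lower-generation residual weights through the reference new side `J⁰_P(s)` (`θ`'s weights with the top-generation factor set to `1`).  Since K1⁹ quantifies `∃θ` and
the rows constrain the residual 𝐓-weight slot `Zh` only by SIGN (`zhLaws`), TWO-SCALE LOCALITY (`zhLocal`) and UNITY (`ZhUnity`), the lower generations are the prover's too.  §1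
`TkOfRecord_congr_weights` ∕ `sect2Slot_congr_weights`: 11a's `𝐓_n(s)` reads the weight datum only through `ζ_j(Ω_{j+1}ᶜ)` and `w_j(Λ_{j+1}, Λ_{j+1}ᶜ ∩ Ω_{j+1}, S_{j+1})`, `j < n`
(D's branch congruence, summed over the branches).  §2 THE UNIT-WEIGHT RESIDUAL CLASS next to `θ`: parameters `θu` with `θu.toStage13RParams = θ.toStage13RParams` and
`(θu.Zh p n Ω Λ).ζ0 j Y ω = 𝟙{Y = (Ω (j+1))ᶜ}`, `(θu.Zh p n Ω Λ).quad j Λ′ ω = 0` — the slot is indexed by the history's OWN set-sequence `Ω`, so every history reads ζ-weight `1` at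
every generation (`WtOfRecord₁₃H_ζ_region_eq_one`) and the bare A-weights `χ(Y, S)·e⁰` (`WtOfRecord₁₃H_w_eq_bare`); the rows hold OUTRIGHT (`zhLaws_of_unitResidual`,
`zhLocal_of_unitResidual` — constant in `ω` —, ★ `zhUnity_of_unitResidual` — ONE region carries the unit weight); the class is inhabited next to every `θ` with the same `Phih`
(`exists_unitResidual`; ★ `exists_fullClass_of_threeConjuncts`: `ZhUnity` is never an obstruction — K0's antecedent asks nothing of the slot beyond the rows); and ★★ `sect2Slot_unitResidual_eq_bare`: at such `θu`, for every history `s` of length `k+1`, terms `t`, constant `E`, background `U`, the reference new side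
of H (top factor `1`) IS THE BARE NEW SIDE `I_P(s) := sect2Slot … (θu.Rz P.K) ⟨1, 0, χ_A⟩ s t E U` — 11a's `𝐓_{k+1}(s)` with UNIT residual weights (`ζ ≡ 1`, `quad ≡ 0`, the record's
own fluctuation-field characteristic functions `chiAW`) on the exponential operand, at the TORUS residual (`sect2Slot_congr_residual`): a function of `θu.toStage13RParams` ALONE.  §3
★★★★★ `exists_thm1Printed_datum_by_fiat_of_bareSupports`: from ANY `θ` with `Provisos₁₃SepCoPH ∧ SlotsNondegenerate₁₃ ∧ Admissible` — `ZhUnity` NOT assumed — there is `θ′ h′` IN K1⁹'s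
FULL hypothesis class (unity MANUFACTURED), same `Stage13RParams`, such that for every `γ > 0` the signs and the BARE support conditions along the `γ`-window runs (a.e. on the
`χ_{k+1}(s)`-support: `0 < ρ_{k+1}(s)(V) → 0 < I⁰_P(s)(V)`, ZERO terms, constants `e_P`) give `B16.Thm1Printed (datumOfRecord₁₃SepCoPH θ′ h′).C` (H applied at `θu`, §2).  ★★★★★★
`k1_consequent_of_residualBlind_remainder_of_bareSupports`: K1⁹'s CONSEQUENT VERBATIM from: `θ` with the three R-side class conjuncts, the signs, a version `v` with `Cor3_250`, the
window, the run rows (i) (iv) (C) — all at `θ` — and the BARE support conditions.  EVERY hypothesis now reads the residual slots `Zh` ∕ `Phih` ONLY through the rows `zhLaws` ∕ `zhLocal`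
of `Provisos₁₃SepCoPH θ` (satisfiable next to any R-data, §2): IN K1⁹ v10 THE RESIDUAL 𝐓-WEIGHT SLOT AND THE SMEARING SLOT CARRY NO CONTENT; what carries content is the antecedent's
R-data (K0), [III] Cor. 3 ∕ (0.1) at a version, the window and run rows, and ONE qualitative R-level statement per history — the support inclusion of def-R's post-𝐑 slot
`ρ_{k+1}(s)` in 11a's bare integral `I⁰_P(s)` on the `χ_{k+1}(s)`-support (where it can fail in the kernel: non-measurable ∕ non-integrable integrands make `I⁰ = 0` by the
integral's junk value; where it holds in print: (2.18)'s summands are positive integrals of positive functions).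

HONEST FRAMING.  A REDUCTION and a READING on the tree's own rows and objects (count-neutral, LOCATED): nothing of Bałaban asserted or refuted; the bare support conditions are NOT
claimed at any `θ`; `Cor3_250`, the window, the run rows are HYPOTHESES, not inhabited — NO K1⁹ witness is produced, K1⁹'s `∃θ` neither advanced nor refuted; no `Stage13HParams` of
record constructed or modified (anonymous-constructor parameters next to an arbitrary `θ`; the unit-weight residual is NOT print's `ζ(Ω_{k+1})`, which is a resummed sum of
characteristic functions × gauge-fixing factors — it is a ROW-ABIDING member of the typed class, exhibited to locate what the rows do not say); N11 NOT discharged; K1⁹ NOT closed; no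
registered stub touched; counts unmoved (typed 28∕28 · discharged 8∕27 = 8∕28 incl. NODE O).  One finite four-torus programme at fixed `ε = L^{−K}`; NOT ℝ⁴, NOT OS, NOT a mass gap,
NOT Clay.  No `sorry`, `axiom`, `def`, `instance`, `notation`.  Sources (SHAPE only): [V] Thm 1 p.355, (0.1) pp.355–356; [III] Thm 1 p.262, Cor. 3 (2.50) p.264, (2.17)–(2.18) p.257,
(2.20)–(2.23) p.258, p.267, (3.2) p.265, (3.16)–(3.21) pp.268–269, (3.23)–(3.25) p.270; [IV] (0.2)–(0.4) pp.176–177.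
-/

noncomputable section

open MeasureTheory
open scoped BigOperators Matrix.Norms.L2Operator

namespace Summit.QuantumFields.YangMills.Theorems.BalabanUVNodesN11K1SupportsAtUnitResidual

open Literature.MathematicalPhysics.QuantumFieldTheory.Balaban1983to89 T4Continuum Node00 Node00.Tk B14.Eq218Concrete B14.Sect3Decomp
open BalabanUVNodesN11TopPairLocalResidual (WtOfRecord₁₃H_ζ_eq_ζ0)
open BalabanUVNodesN11NoExpansionDiagonalCoPH (sect2Slot_congr_residual)
open BalabanUVNodesN11AllStepsQuadSlot (tkBranchOfRecord_congr_below)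
open BalabanUVNodesN11TopPairQuadSlotK1Hypotheses (provisos₁₃SepCoPH_of_sameR slotsNondegenerate₁₃_of_sameR admissible_of_sameR)
open BalabanUVNodesN11K1BFaceSect2FormBySupports (exists_thm1Printed_datum_by_fiat_of_supports_of_hypotheses)
open BalabanUVNodesN11K1ResidualBlindReduction (exists_revision₁₃_cor3_iff_of_sameR betaOfRecord₁₃_eq_of_sameR)

variable {F : T4Family} {N : ℕ} [NeZero N]

/-! ## §1. 11a's `𝐓_n(s)` reads the weight datum only through `ζ_j(Ω_{j+1}ᶜ)` and the generation A-weights, `j < n` -/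

section Congr

variable (ν : Stage7Numerics) (M : ℕ) (g : ℕ → ℝ) (K : ℕ)

/-- **`𝐓_n(s)[W]` IS DETERMINED BY `ζ_j(Ω_{j+1}ᶜ)` AND `w_j(Λ_{j+1}, Λ_{j+1}ᶜ ∩ Ω_{j+1}, ·)`, `j < n`**: weight data agreeing there give the same `𝐓_n(s)` on every operand (D's branch
congruence summed over the `{S_j}`-branches). [cite: Balaban1988Convergent, (2.18) p.257, (2.20)–(2.21) p.258, (3.24) p.270 (bookkeeping)] -/
theorem TkOfRecord_congr_weights {W W' : TkWeights F N (FluctV N) K} {n : ℕ} (s : SeqOfRecord F ν M g K n)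
    (hζ : ∀ j, j < n → W'.ζ j (s.Ω (j + 1))ᶜ = W.ζ j (s.Ω (j + 1))ᶜ)
    (hw : ∀ j, j < n → ∀ S₁, W'.w j (s.Λ (j + 1)) ((s.Λ (j + 1))ᶜ ∩ s.Ω (j + 1)) S₁ = W.w j (s.Λ (j + 1)) ((s.Λ (j + 1))ᶜ ∩ s.Ω (j + 1)) S₁)
    (Φ : SFluct (F.P K) (FluctV N) → B15DeterminingSets.MSField (F.P K) (SU N) → ℝ) (V : GaugeField (F.P K) n (SU N)) :
    TkOfRecord F N (FluctV N) ν M g K W' n s Φ V = TkOfRecord F N (FluctV N) ν M g K W n s Φ V := by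
  rw [TkOfRecord_apply, TkOfRecord_apply]
  exact Finset.sum_congr rfl fun S _ => by rw [tkBranchOfRecord_congr_below ν M g K s S n hζ (fun j hj => hw j hj (S (j + 1)))]

/-- … hence the same §2-form slot, for every setting, residual, terms, constant and background. [cite: Balaban1988Convergent, (2.18) p.257, (2.21)–(2.23) p.258 (bookkeeping)] -/
theorem sect2Slot_congr_weights {𝔸 : Type*} [NormedRing 𝔸] [NormedAlgebra ℂ 𝔸] [CompleteSpace 𝔸] {W W' : TkWeights F N (FluctV N) K} {n : ℕ} (s : SeqOfRecord F ν M g K n)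
    (hζ : ∀ j, j < n → W'.ζ j (s.Ω (j + 1))ᶜ = W.ζ j (s.Ω (j + 1))ᶜ)
    (hw : ∀ j, j < n → ∀ S₁, W'.w j (s.Λ (j + 1)) ((s.Λ (j + 1))ᶜ ∩ s.Ω (j + 1)) S₁ = W.w j (s.Λ (j + 1)) ((s.Λ (j + 1))ᶜ ∩ s.Ω (j + 1)) S₁)
    (Sg : Sect2.Setting 𝔸 (SU N)) (Rz : Sect2.Residual (F.P K) 𝔸) (t : Sect2.TermValues (F.P K) 𝔸 (FluctV N) M) (E' : ℝ) (U : BgMap F N K) (V : GaugeField (F.P K) n (SU N)) :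
    sect2Slot F N (FluctV N) K Sg Rz W' s t E' U V = sect2Slot F N (FluctV N) K Sg Rz W s t E' U V :=
  TkOfRecord_congr_weights ν M g K s hζ hw _ V

end Congr

/-! ## §2. The unit-weight residual class next to `θ`: rows OUTRIGHT, inhabited, and its reference new sides are the BARE new sides (R-level) -/

section UnitResidual

variable {θ θu : Stage13HParams F N}

/-- **THE UNIT-WEIGHT RESIDUAL CLASS IS INHABITED NEXT TO EVERY `θ`** (same `Stage13RParams` data AND `Phih`): the history-adapted indicator `ζ0_j(Y) := 𝟙{Y = (Ω (j+1))ᶜ}`, `quad_j := 0`.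
[cite: Balaban1988Convergent, p.267, (3.16)–(3.20) pp.268–269, (2.21) p.258 (bookkeeping)] -/
theorem exists_unitResidual (θ : Stage13HParams F N) :
    ∃ θu : Stage13HParams F N, θu.toStage13RParams = θ.toStage13RParams ∧ θu.Phih = θ.Phih ∧
      (∀ p n Ω Λ j Y ω, (θu.Zh p n Ω Λ).ζ0 j Y ω = Set.indicator {(Ω (j + 1))ᶜ} (1 : Set (Site (F.P p.K) 0) → ℝ) Y) ∧
      (∀ p n Ω Λ j Λ' ω, (θu.Zh p n Ω Λ).quad j Λ' ω = 0) :=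
  ⟨{ θ with Zh := fun p _ Ω _ => ⟨fun j Y _ => Set.indicator {(Ω (j + 1))ᶜ} (1 : Set (Site (F.P p.K) 0) → ℝ) Y, fun _ _ _ => 0⟩ },
    rfl, rfl, fun _ _ _ _ _ _ _ => rfl, fun _ _ _ _ _ _ _ => rfl⟩

variable (hζ : ∀ p n Ω Λ j Y ω, (θu.Zh p n Ω Λ).ζ0 j Y ω = Set.indicator {(Ω (j + 1))ᶜ} (1 : Set (Site (F.P p.K) 0) → ℝ) Y)
  (hq : ∀ p n Ω Λ j Λ' ω, (θu.Zh p n Ω Λ).quad j Λ' ω = 0)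
include hζ

/-- Row `zhLaws` (12a: `ζ0 ≥ 0`) holds OUTRIGHT at the unit-weight residual. [cite: Balaban1988Convergent, p.267 (bookkeeping)] -/
theorem zhLaws_of_unitResidual : ∀ p n Ω Λ, (θu.Zh p n Ω Λ).Laws := fun p n Ω Λ =>
  ⟨fun j Y ω => by rw [hζ]; exact Set.indicator_nonneg (fun _ _ => zero_le_one) _⟩

/-- Row `zhLocal` (print's TWO-SCALE locality law, T1′) holds OUTRIGHT at the unit-weight residual (it is constant in the configuration). [cite: Balaban1988Convergent, (3.2)–(3.4) p.265, p.267 (bookkeeping)] -/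
theorem zhLocal_of_unitResidual : ∀ p n Ω Λ, (θu.Zh p n Ω Λ).LocalLaws := fun p n Ω Λ =>
  ⟨fun j Y ω ω' _ _ => by rw [hζ, hζ]⟩

/-- ★ **PRINT's PARTITION OF UNITY `ZhUnity` HOLDS OUTRIGHT at the unit-weight residual**: one region — the history's own `Ω_{j+1}ᶜ` — carries the unit weight.
[cite: Balaban1988Convergent, (3.16)–(3.20) pp.268–269 (bookkeeping)] -/
theorem zhUnity_of_unitResidual : θu.ZhUnity := by
  intro p n Ω Λ j ω
  simp_rw [hζ]
  rw [finsum_eq_single _ (Ω (j + 1))ᶜ fun Y hY => Set.indicator_of_notMem (by simpa using hY) _]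
  exact Set.indicator_of_mem (Set.mem_singleton _) _

/-- **EVERY HISTORY READS ζ-WEIGHT `1` AT EVERY GENERATION** at the unit-weight residual: `ζ_j(Ω_{j+1}(s)ᶜ) ≡ 1`. [cite: Balaban1988Convergent, (2.21) p.258, p.267 (bookkeeping)] -/
theorem WtOfRecord₁₃H_ζ_region_eq_one (p : B12.RunParams) {n : ℕ} (s : SeqOfRecord F θu.ν θu.τ9.M (gOfRecord₁₃ F N θu.toStage13Params p) p.K n) (j : ℕ) :
    (WtOfRecord₁₃H F N θu p s).ζ j (s.Ω (j + 1))ᶜ = fun _ => 1 := by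
  funext ω
  rw [WtOfRecord₁₃H_ζ_eq_ζ0, hζ]
  exact Set.indicator_of_mem (Set.mem_singleton _) _

omit hζ in
include hq in
/-- **THE A-WEIGHTS ARE BARE** at the unit-weight residual: `w_j(Λ′, Y, S) = χ(Y, S)·e⁰` — the record's own fluctuation-field characteristic functions, no Gaussian factor.
[cite: Balaban1988Convergent, (2.21) p.258, (3.21) p.269, (3.23) p.270 (bookkeeping)] -/
theorem WtOfRecord₁₃H_w_eq_bare (p : B12.RunParams) {n : ℕ} (s : SeqOfRecord F θu.ν θu.τ9.M (gOfRecord₁₃ F N θu.toStage13Params p) p.K n) (j : ℕ)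
    (Λ' Y S₁ : Set (Site (F.P p.K) 0)) :
    (WtOfRecord₁₃H F N θu p s).w j Λ' Y S₁ =
      (⟨fun _ _ _ => 1, fun _ _ _ => 0, chiAW F N (FluctV N) θu.ν θu.A₁ p (gOfRecord₁₃ F N θu.toStage13Params p)⟩ : TkWeights F N (FluctV N) p.K).w j Λ' Y S₁ := by
  funext ω
  show chiAW F N (FluctV N) θu.ν θu.A₁ p (gOfRecord₁₃ F N θu.toStage13Params p) j Y S₁ ω * Real.exp (-(1 / 2 : ℝ) * (θu.Zh p n s.Ω s.Λ).quad j Λ' ω) =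
    chiAW F N (FluctV N) θu.ν θu.A₁ p (gOfRecord₁₃ F N θu.toStage13Params p) j Y S₁ ω * Real.exp (-(1 / 2 : ℝ) * 0)
  rw [hq]

include hq in
/-- ★★ **AT THE UNIT-WEIGHT RESIDUAL THE REFERENCE NEW SIDE IS THE BARE NEW SIDE** (every history `s` of length `k+1`, every setting of terms `t`, constant `E`, background `U`): H's
`J_P(s)` — `θu`'s weights with the top-generation factor set to `1` — equals `I_P(s) := sect2Slot … (θu.Rz P.K) ⟨1, 0, χ_A⟩ s t E U`, 11a's `𝐓_{k+1}(s)` with UNIT residual weights on the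
exponential operand at the TORUS residual — a function of `θu.toStage13RParams` alone (`sect2Slot_congr_weights` + `sect2Slot_congr_residual`). [cite: Balaban1988Convergent, (2.18) p.257, (2.20)–(2.23) p.258, (3.23)–(3.25) p.270 (bookkeeping)] -/
theorem sect2Slot_unitResidual_eq_bare (p : B12.RunParams) {k : ℕ} (s : SeqOfRecord F θu.ν θu.τ9.M (gOfRecord₁₃ F N θu.toStage13Params p) p.K (k + 1))
    (t : Sect2.TermValues (F.P p.K) (MatA N) (FluctV N) θu.τ9.M) (E' : ℝ) (U : BgMap F N p.K) (V : GaugeField (F.P p.K) (k + 1) (SU N)) :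
    sect2Slot F N (FluctV N) p.K (settingOfRecord₁₃ F N θu.toStage13Params p) (θu.rzAt p s)
        { WtOfRecord₁₃H F N θu p s with ζ := fun j Y ω => if j = k then 1 else (WtOfRecord₁₃H F N θu p s).ζ j Y ω } s t E' U V =
      sect2Slot F N (FluctV N) p.K (settingOfRecord₁₃ F N θu.toStage13Params p) (θu.Rz p.K)
        (⟨fun _ _ _ => 1, fun _ _ _ => 0, chiAW F N (FluctV N) θu.ν θu.A₁ p (gOfRecord₁₃ F N θu.toStage13Params p)⟩ : TkWeights F N (FluctV N) p.K) s t E' U V := by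
  rw [sect2Slot_congr_residual _ (θu.rzAt p s) (θu.Rz p.K)]
  refine sect2Slot_congr_weights θu.ν θu.τ9.M (gOfRecord₁₃ F N θu.toStage13Params p) p.K s (fun j _ => ?_) (fun j _ S₁ => ?_) _ _ t E' U V
  · funext ω
    show (if j = k then (1 : ℝ) else (WtOfRecord₁₃H F N θu p s).ζ j (s.Ω (j + 1))ᶜ ω) = 1
    split_ifs with h
    · rfl
    · rw [WtOfRecord₁₃H_ζ_region_eq_one hζ p s j]
  · exact WtOfRecord₁₃H_w_eq_bare hq p s j _ _ S₁

omit hζ in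
/-- ★ **`ZhUnity` IS NEVER AN OBSTRUCTION**: from ANY `θ` with `Provisos₁₃SepCoPH ∧ SlotsNondegenerate₁₃ ∧ Admissible` there is a parameter with the same `Stage13RParams` data and
`Phih` in K1⁹'s FULL hypothesis class (the unit-weight residual next to `θ`) — K0's antecedent asks nothing of the residual slot beyond the rows. [cite: Balaban1988Convergent, (3.16)–(3.20) pp.268–269, p.267 (bookkeeping)] -/
theorem exists_fullClass_of_threeConjuncts (θ : Stage13HParams F N) (hP : θ.Provisos₁₃SepCoPH F N) (hS : θ.SlotsNondegenerate₁₃ F N) (hA : θ.Admissible F N) :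
    ∃ θu : Stage13HParams F N, θu.toStage13RParams = θ.toStage13RParams ∧ θu.Phih = θ.Phih ∧
      θu.Provisos₁₃SepCoPH F N ∧ (θu.ZhUnity ∧ θu.SlotsNondegenerate₁₃ F N) ∧ θu.Admissible F N := by
  obtain ⟨θu, h1, h2, hζ, -⟩ := exists_unitResidual θ
  exact ⟨θu, h1, h2, provisos₁₃SepCoPH_of_sameR h1 hP (zhLaws_of_unitResidual hζ) (zhLocal_of_unitResidual hζ),
    ⟨zhUnity_of_unitResidual hζ, slotsNondegenerate₁₃_of_sameR h1 hS⟩, admissible_of_sameR h1 hA⟩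

end UnitResidual

/-! ## §3. K1⁹'s (B)-face `Thm1Printed` by fiat from the BARE (R-level) support conditions; K1⁹'s consequent from its residual-blind remainder and the bare supports -/

section Reduction

/-- ★★★★★ **K1⁹'s (B)-FACE CONJUNCT BY FIAT FROM R-LEVEL SUPPORT CONDITIONS, UNITY MANUFACTURED.**  From ANY `θ` with `Provisos₁₃SepCoPH ∧ SlotsNondegenerate₁₃ ∧ Admissible`
(`ZhUnity` NOT assumed) and constants `e_P` there is `θ′ h′` IN K1⁹'s FULL hypothesis class (`Provisos₁₃SepCoPH`, `ZhUnity ∧ SlotsNondegenerate₁₃`, `Admissible`) with the SAME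
`Stage13RParams` data such that for every `γ > 0`: the signs `0 ≤ E₀, B₀` and, along every run `P` of the `γ`-window and every step `k < K`, the BARE support condition (a.e. on the
`χ_{k+1}(s)`-support: `0 < ρ_{k+1}(s)(V) → 0 < I⁰_P(s)(V)`, `I⁰_P(s)` = 11a's `𝐓_{k+1}(s)` with UNIT residual weights `⟨1, 0, χ_A⟩` on `e^{A_{k+1}(s; 0, e_P)}∘U_{k+1}` at the torus
residual — R-LEVEL) ALONE give `B16.Thm1Printed (datumOfRecord₁₃SepCoPH F N θ′ h′).C`.  LOCATED, count-neutral; the bare supports are NOT claimed at any `θ`; nothing of Bałaban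
asserted or refuted. [cite: Balaban1989LargeFieldII, Thm 1 p.355; Balaban1988Convergent, Thm 1 p.262, (2.17)–(2.18) p.257, (2.20)–(2.23) p.258, p.267, (3.16)–(3.21) pp.268–269, (3.23)–(3.25) p.270; Balaban1989LargeFieldI, (0.2)–(0.4) pp.176–177] -/
theorem exists_thm1Printed_datum_by_fiat_of_bareSupports (θ : Stage13HParams F N) (hP : θ.Provisos₁₃SepCoPH F N)
    (hS : θ.SlotsNondegenerate₁₃ F N) (hA : θ.Admissible F N) (e : B12.RunParams → ℝ) :
    ∃ (θ' : Stage13HParams F N) (h' : θ'.Provisos₁₃SepCoPH F N), θ'.toStage13RParams = θ.toStage13RParams ∧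
      (θ'.ZhUnity ∧ θ'.SlotsNondegenerate₁₃ F N) ∧ θ'.Admissible F N ∧
      ∀ γ : ℝ, 0 < γ → 0 ≤ θ.s2.lf.E₀ → 0 ≤ θ.s2.lf.B₀ →
        (∀ P : B12.RunParams, (settingOfRecord₁₃ F N θ.toStage13Params P).flow.InInterval γ P.K → ∀ k, k < P.K →
          ∀ s : SeqOfRecord F θ.ν θ.τ9.M (gOfRecord₁₃ F N θ.toStage13Params P) P.K (k + 1),
            ∀ᵐ V ∂fieldMeasure (F.P P.K) (k + 1) (SU N), chiSeqOfRecord F N θ.ν θ.τ9.M (gOfRecord₁₃ F N θ.toStage13Params P) P.K (k + 1) s V ≠ 0 →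
              0 < slotsOfRecord F N θ.ν θ.τ9 (EOfRecord₁₃ F N θ.toStage13Params) (wOfRecord₉ F N θ.toStage9Params) θ.ppSel P (gOfRecord₁₃ F N θ.toStage13Params P) (k + 1) s V →
              0 < sect2Slot F N (FluctV N) P.K (settingOfRecord₁₃ F N θ.toStage13Params P) (θ.Rz P.K)
                (⟨fun _ _ _ => 1, fun _ _ _ => 0, chiAW F N (FluctV N) θ.ν θ.A₁ P (gOfRecord₁₃ F N θ.toStage13Params P)⟩ : TkWeights F N (FluctV N) P.K)
                s Sect2.TermValues.zero (e P) (UbgOfRecord₁₃CoP F N θ.toStage13Params P (k + 1) s) V) →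
        B16.Thm1Printed (datumOfRecord₁₃SepCoPH F N θ' h').C := by
  -- the unit-weight residual next to `θ`
  let θ₁ : Stage13HParams F N :=
    { θ with Zh := fun p _ Ω _ => ⟨fun j Y _ => Set.indicator {(Ω (j + 1))ᶜ} (1 : Set (Site (F.P p.K) 0) → ℝ) Y, fun _ _ _ => 0⟩ }
  have hζ : ∀ p n Ω Λ j Y ω, (θ₁.Zh p n Ω Λ).ζ0 j Y ω = Set.indicator {(Ω (j + 1))ᶜ} (1 : Set (Site (F.P p.K) 0) → ℝ) Y := fun _ _ _ _ _ _ _ => rfl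
  have hq : ∀ p n Ω Λ j Λ' ω, (θ₁.Zh p n Ω Λ).quad j Λ' ω = 0 := fun _ _ _ _ _ _ _ => rfl
  have h1 : θ₁.toStage13RParams = θ.toStage13RParams := rfl
  have hP₁ : θ₁.Provisos₁₃SepCoPH F N := provisos₁₃SepCoPH_of_sameR h1 hP (zhLaws_of_unitResidual hζ) (zhLocal_of_unitResidual hζ)
  obtain ⟨θ', h', h1', -, hUS', hA', hthm⟩ := exists_thm1Printed_datum_by_fiat_of_supports_of_hypotheses θ₁ hP₁ (zhUnity_of_unitResidual hζ)
    (slotsNondegenerate₁₃_of_sameR h1 hS) (admissible_of_sameR h1 hA) e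
  refine ⟨θ', h', h1'.trans h1, hUS', hA', fun γ hγ hE₀ hB₀ hsupp => hthm γ hγ hE₀ hB₀ fun P hI k hk s => ?_⟩
  filter_upwards [hsupp P hI k hk s] with V hV hχ hρ
  rw [sect2Slot_unitResidual_eq_bare hζ hq P s]
  exact hV hχ hρ

/-- ★★★★★★ **K1⁹'s CONSEQUENT FROM ITS RESIDUAL-BLIND REMAINDER AND THE BARE SUPPORTS.**  Let `θ` carry the three R-side class conjuncts (`Provisos₁₃SepCoPH`, `SlotsNondegenerate₁₃`,
`Admissible`; `ZhUnity` NOT needed) and the signs `0 ≤ E₀, B₀`; suppose AT `θ`: a version `v` with `Cor3_250 (datumOfRecord₁₃SepCoPHV θ hP v).C`, the non-vacuity window, the run rows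
(i) (iv) (C) of `betaOfRecord₁₃ θ`; and the BARE support conditions along some `γ`-window (a.e. on the `χ_{k+1}(s)`-support: `0 < ρ_{k+1}(s)(V) → 0 < I⁰_P(s)(V)`).  THEN K1⁹'s CONSEQUENT
HOLDS VERBATIM.  Every hypothesis reads the residual slots `Zh` ∕ `Phih` only through the rows `zhLaws` ∕ `zhLocal` inside `Provisos₁₃SepCoPH θ` — in K1⁹ v10 the residual slots carry
no content.  LOCATED, count-neutral: remainder and bare supports are HYPOTHESES, not inhabited; no K1⁹ witness; nothing of Bałaban asserted or refuted. [cite: Balaban1989LargeFieldII, Thm 1 + (0.1) pp.355–356; Balaban1988Convergent, Thm 1 p.262, Cor. 3 (2.50) p.264, (2.17)–(2.18) p.257, (2.20)–(2.23) p.258, (3.23)–(3.25) p.270; Balaban1989LargeFieldI, (0.2)–(0.4) pp.176–177] -/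
theorem k1_consequent_of_residualBlind_remainder_of_bareSupports (θ : Stage13HParams F N) (hP : θ.Provisos₁₃SepCoPH F N)
    (hS : θ.SlotsNondegenerate₁₃ F N) (hA : θ.Admissible F N) (hE₀ : 0 ≤ θ.s2.lf.E₀) (hB₀ : 0 ≤ θ.s2.lf.B₀) (e : B12.RunParams → ℝ)
    (v : Revision₁₃ F N θ hP) (hcor : B16.Cor3_250 (datumOfRecord₁₃SepCoPHV F N θ hP v).C)
    (hwin : ∃ γ₁ : ℝ, 0 < γ₁ ∧ ∀ γ : ℝ, 0 < γ → γ ≤ γ₁ → ∃ P : B12.RunParams, 1 ≤ P.K ∧ ((datumOfRecord₁₃SepCoPHV F N θ hP v).C P).flow.InInterval γ P.K)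
    (hrows : ∃ (b : ℕ → ℝ) (r γ₀ M : ℝ), 0 < γ₀ ∧
      (∀ (n : ℕ) (gs : ℕ → ℝ), FlowStep.RGEqH n (betaOfRecord₁₃ F N θ.toStage13Params) gs → Step.InInterval γ₀ n gs →
        ∀ k, k ≤ n → |betaOfRecord₁₃ F N θ.toStage13Params k (FlowStep.prefixOf gs k) - b k| ≤ r) ∧
      (∀ (n : ℕ) (gs : ℕ → ℝ), FlowStep.RGEqH n (betaOfRecord₁₃ F N θ.toStage13Params) gs → Step.InInterval γ₀ n gs →
        ∀ k, k ≤ n → -M ≤ ∑ j ∈ Finset.Ico k n, betaOfRecord₁₃ F N θ.toStage13Params j (FlowStep.prefixOf gs j)) ∧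
      ∀ k : ℕ, ContinuousOn (fun x : ℝ => betaOfRecord₁₃ F N θ.toStage13Params k (FlowStep.clampPrefix (betaOfRecord₁₃ F N θ.toStage13Params) γ₀ k x))
        {x : ℝ | 0 < x ∧ x ≤ γ₀ ∧ ∀ j, j ≤ k → 1 / γ₀ ^ 2 ≤ FlowStep.Y (betaOfRecord₁₃ F N θ.toStage13Params) γ₀ j x})
    (hsupp : ∃ γ : ℝ, 0 < γ ∧ ∀ P : B12.RunParams, (settingOfRecord₁₃ F N θ.toStage13Params P).flow.InInterval γ P.K → ∀ k, k < P.K →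
      ∀ s : SeqOfRecord F θ.ν θ.τ9.M (gOfRecord₁₃ F N θ.toStage13Params P) P.K (k + 1),
        ∀ᵐ V ∂fieldMeasure (F.P P.K) (k + 1) (SU N), chiSeqOfRecord F N θ.ν θ.τ9.M (gOfRecord₁₃ F N θ.toStage13Params P) P.K (k + 1) s V ≠ 0 →
          0 < slotsOfRecord F N θ.ν θ.τ9 (EOfRecord₁₃ F N θ.toStage13Params) (wOfRecord₉ F N θ.toStage9Params) θ.ppSel P (gOfRecord₁₃ F N θ.toStage13Params P) (k + 1) s V →
          0 < sect2Slot F N (FluctV N) P.K (settingOfRecord₁₃ F N θ.toStage13Params P) (θ.Rz P.K)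
            (⟨fun _ _ _ => 1, fun _ _ _ => 0, chiAW F N (FluctV N) θ.ν θ.A₁ P (gOfRecord₁₃ F N θ.toStage13Params P)⟩ : TkWeights F N (FluctV N) P.K)
            s Sect2.TermValues.zero (e P) (UbgOfRecord₁₃CoP F N θ.toStage13Params P (k + 1) s) V) :
    ∃ (θ' : Stage13HParams F N) (h' : θ'.Provisos₁₃SepCoPH F N) (v' : Revision₁₃ F N θ' h'),
      (θ'.ZhUnity ∧ θ'.SlotsNondegenerate₁₃ F N) ∧ θ'.Admissible F N ∧ B16.EndStatementBPrinted (datumOfRecord₁₃SepCoPHV F N θ' h' v').C ∧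
      (∃ γ₁ : ℝ, 0 < γ₁ ∧ ∀ γ : ℝ, 0 < γ → γ ≤ γ₁ → ∃ P : B12.RunParams, 1 ≤ P.K ∧ ((datumOfRecord₁₃SepCoPHV F N θ' h' v').C P).flow.InInterval γ P.K) ∧
      ∃ (b : ℕ → ℝ) (r γ₀ M : ℝ), 0 < γ₀ ∧
        (∀ (n : ℕ) (gs : ℕ → ℝ), FlowStep.RGEqH n (betaOfRecord₁₃ F N θ'.toStage13Params) gs → Step.InInterval γ₀ n gs →
          ∀ k, k ≤ n → |betaOfRecord₁₃ F N θ'.toStage13Params k (FlowStep.prefixOf gs k) - b k| ≤ r) ∧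
        (∀ (n : ℕ) (gs : ℕ → ℝ), FlowStep.RGEqH n (betaOfRecord₁₃ F N θ'.toStage13Params) gs → Step.InInterval γ₀ n gs →
          ∀ k, k ≤ n → -M ≤ ∑ j ∈ Finset.Ico k n, betaOfRecord₁₃ F N θ'.toStage13Params j (FlowStep.prefixOf gs j)) ∧
        ∀ k : ℕ, ContinuousOn (fun x : ℝ => betaOfRecord₁₃ F N θ'.toStage13Params k (FlowStep.clampPrefix (betaOfRecord₁₃ F N θ'.toStage13Params) γ₀ k x))
          {x : ℝ | 0 < x ∧ x ≤ γ₀ ∧ ∀ j, j ≤ k → 1 / γ₀ ^ 2 ≤ FlowStep.Y (betaOfRecord₁₃ F N θ'.toStage13Params) γ₀ j x} := by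
  obtain ⟨θ', h', h1, hUS', hA', hthm⟩ := exists_thm1Printed_datum_by_fiat_of_bareSupports θ hP hS hA e
  obtain ⟨v', -, hcorIff, hflow, hthmIff⟩ := exists_revision₁₃_cor3_iff_of_sameR h1 hP h' v
  obtain ⟨γ, hγ, hsup⟩ := hsupp
  refine ⟨θ', h', v', hUS', hA', ⟨hthmIff.2 (hthm γ hγ hE₀ hB₀ hsup), hcorIff.2 hcor⟩, ?_, ?_⟩
  · obtain ⟨γ₁, hγ₁, hw⟩ := hwin
    refine ⟨γ₁, hγ₁, fun γ' hγ' hle => ?_⟩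
    obtain ⟨P, hK, hI⟩ := hw γ' hγ' hle
    exact ⟨P, hK, by rw [hflow P]; exact hI⟩
  · rw [betaOfRecord₁₃_eq_of_sameR h1]
    exact hrows

end Reduction

end Summit.QuantumFields.YangMills.Theorems.BalabanUVNodesN11K1SupportsAtUnitResidual

end
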